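import Mathlib
import HarnessLib
import Summits.HubbardSuperconductivity.HubbardSuperconductivity.Theorems.KLProgrammeKLRegimeSplitEdgeFactsRungJetsTransport
import Summits.HubbardSuperconductivity.HubbardSuperconductivity.Theorems.KLProgrammeKLRegimeSplitEdgeFactsBubblePin

/-!
# Route `KLProgramme` — edge facts for the pair masses ACROSS TRANSFERS, X: the COMPLEMENTARY MEMBERS `φ = s_{n,m} = w_{Λ_m} − w_{Λ_n}` (`m ≥ n+1`) — support facts,
# flatness of the lower weight, and the two POINTWISE jet bounds of the (D2)-deep row, uniformly in `m`

Cell gate-hubbard-kl, seat hubbard-kl-k3c1-p1 (g21; child-1 lineage; technique: composed-map remainder propagation).  Pointwise half of the (D2)-deep row for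
`klTransferWeight … n (softSymbolCompl … n m)` (assembled in `…TransferModulusComplDeep`), under the DEEP CONDITION `(4 + coeffNorm 1 K)·|p_Q|_𝕋 ≤ Λ_n/16`:
* §1 support facts: `w_Λ ≠ 0 ⇒ (Λ/2)² ≤ ω² + e_K²`; `Λ² ≤ ω² + e_K² ⇒ w_Λ = 1`; `φ ≠ 0 ⇒ ω² + e_K² < Λ_n²`, `|e_K| < Λ_n`; `Λ_m ≤ Λ_n/4`;
  **`Λ_n²/16 ≤ ω² + e_K² ⇒ φ = 1 − w_{Λ_n}`** (the lower weight is FLAT there — this is what makes everything `m`-uniform); evenness of `φ`; support of the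
  transfer weight: `Λ_n + (4 + coeffNorm 1 K)|p_Q|_𝕋 ≤ |e_K(p)| ⇒ t_n[φ](Q,p) = 0`, so ANY ball containing `{|e_K| < Λ_n + (4 + coeffNorm 1 K)|p_Q|_𝕋}` sums to the full sum
  (`klcd_sum_transferWeight_subset_eq` — the ball restriction of the named masses is inactive).
* §2 TERM 1 (`w_{Λ_n}(ν,p) ≠ 0`, `φ ≠ 0` at one of `p, p ± Q`): centre `A = Λ_n/2`, `|e_K(p)| ≤ 17Λ_n/16`, transport (row 22), flatness ⇒ the profile differences of `φ`
  are those of `w_{Λ_n}` ⇒ **`klcd_term1_pointwise`**: `‖δ²_Q(φĝ)(ν,p)‖ ≤ B₁` (row 21 §2–§3 closed form; `B₁ ≲ 10³(κ′ + v′²)|p_Q|_𝕋²/Λ_n³`).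
* §3 TERM 2 (`φ(ν,p) ≠ 0`, `w_{Λ_n} ≠ 0` at one of `p, p ± Q`): quarter lemma from the hard point ⇒ centre `A′ = Λ_n/4` (NO `1/√(ω² + e²)` singularity), transport ⇒
  **`klcd_term2_pointwise`**: soft line `|φ|‖ĝ‖ ≤ 4/Λ_n` and `‖δ²_Q(w_{Λ_n}ĝ)(ν,p)‖ ≤ B₂` (row 21 §4 closed form).
Everything is proved; no definitions; nothing asserts any slot, stub, K3 or SC. [folklore]
-/

noncomputable section

namespace Summit.HubbardSuperconductivity.HubbardSuperconductivity.Theorems.KLRegimeSplit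

set_option linter.dupNamespace false -- summit = problem name (single-conjunct summit), D-0017

open Real Finset Literature.MathematicalPhysics.QuantumLattice Literature.Probability.LatticeModels
open Literature.MathematicalPhysics.QuantumLattice.FermiRG
open Summit.HubbardSuperconductivity.HubbardSuperconductivity.Theorems.KLProgrammeLegKernels
open Summit.HubbardSuperconductivity.HubbardSuperconductivity.Theorems.TwoPointAssembly

section ComplDeep

variable {L M : ℕ} [NeZero L] (β μ : ℝ) (K : TrigPolyC4v)

/-! ## §1 Support facts of the two weights and of the complementary member -/

omit [NeZero L] in
/-- **A nonzero hard weight sits above half the scale**: `0 < Λ`, `w_Λ(k) ≠ 0` ⟹ `(Λ/2)² ≤ ω_k² + e_K(k⃗)²` (`χ₂ = 0` below `1/4`). [folklore] -/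
theorem klcd_sq_le_of_cutoffWeight_ne_zero {Λ : ℝ} (hΛ : 0 < Λ) (k : FreqMomentum L M) (hw : hubbardCutoffWeightCT L M β μ K Λ k ≠ 0) :
    (Λ / 2) ^ 2 ≤ matsubaraFreq β M k.1 ^ 2 + nambuXiCT L μ K k.2 ^ 2 := by
  by_contra h
  push Not at h
  refine hw (salmhoferCutoff_of_le ?_)
  rw [div_le_iff₀ (by positivity)]
  nlinarith

omit [NeZero L] in
/-- **The hard weight is flat above the scale**: `0 < Λ`, `Λ² ≤ ω_k² + e_K(k⃗)²` ⟹ `w_Λ(k) = 1` (`χ₂ = 1` above `1`). [folklore] -/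
theorem klcd_cutoffWeight_eq_one_of_sq_le {Λ : ℝ} (hΛ : 0 < Λ) (k : FreqMomentum L M) (h : Λ ^ 2 ≤ matsubaraFreq β M k.1 ^ 2 + nambuXiCT L μ K k.2 ^ 2) :
    hubbardCutoffWeightCT L M β μ K Λ k = 1 := by
  refine salmhoferCutoff_of_ge ?_
  rw [le_div_iff₀ (by positivity)]
  linarith

/-- **Scales**: `n + 1 ≤ m` ⟹ `Λ_m ≤ Λ_n/4` (`Λ_j = 4^{-j}/32`). [folklore] -/
theorem klcd_klScale_le_quarter {n m : ℕ} (hnm : n + 1 ≤ m) : klScale klE0 m ≤ klScale klE0 n / 4 := by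
  rw [← klth_klScale_succ]
  have h4 : (4 : ℝ) ^ (n + 1) ≤ (4 : ℝ) ^ m := pow_le_pow_right₀ (by norm_num) hnm
  have hpos : (0 : ℝ) < (4 : ℝ) ^ (n + 1) := by positivity
  show klE0 * ((4 : ℝ) ^ m)⁻¹ ≤ klE0 * ((4 : ℝ) ^ (n + 1))⁻¹
  exact mul_le_mul_of_nonneg_left (inv_anti₀ hpos h4) (by norm_num [klE0])

omit [NeZero L] in
/-- **A nonzero complementary member sits below the upper scale**: `n + 1 ≤ m`, `s_{n,m}(k) ≠ 0` ⟹ `ω_k² + e_K(k⃗)² < Λ_n²` and `|e_K(k⃗)| < Λ_n`. [folklore] -/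
theorem klcd_sq_lt_of_soft_ne_zero [NeZero M] {n m : ℕ} (hnm : n + 1 ≤ m) (k : FreqMomentum L M) (hφ : softSymbolCompl L M β μ K n m k ≠ 0) :
    matsubaraFreq β M k.1 ^ 2 + nambuXiCT L μ K k.2 ^ 2 < klScale klE0 n ^ 2 ∧ |nambuXiCT L μ K k.2| < klScale klE0 n := by
  have hΛn := klth_klScale_pos n
  have hΛm := klth_klScale_pos m
  have hmn : klScale klE0 m ≤ klScale klE0 n := (klcd_klScale_le_quarter hnm).trans (by linarith)
  have hlt : matsubaraFreq β M k.1 ^ 2 + nambuXiCT L μ K k.2 ^ 2 < klScale klE0 n ^ 2 := by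
    by_contra h
    push Not at h
    refine hφ ?_
    have h1 := klcd_cutoffWeight_eq_one_of_sq_le β μ K hΛn k h
    have h2 := klcd_cutoffWeight_eq_one_of_sq_le β μ K hΛm k ((pow_le_pow_left₀ hΛm.le hmn 2).trans h)
    simp only [softSymbolCompl, h1, h2, sub_self]
  refine ⟨hlt, ?_⟩
  have hω : 0 ≤ matsubaraFreq β M k.1 ^ 2 := sq_nonneg _
  exact abs_lt_of_sq_lt_sq (by linarith) hΛn.le

omit [NeZero L] in
/-- **Flatness of the lower weight**: `n + 1 ≤ m`, `Λ_n²/16 ≤ ω_k² + e_K(k⃗)²` ⟹ `s_{n,m}(k) = 1 − w_{Λ_n}(k)` (`Λ_m² ≤ Λ_n²/16`, so `w_{Λ_m}(k) = 1`). [folklore] -/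
theorem klcd_soft_eq_one_sub [NeZero M] {n m : ℕ} (hnm : n + 1 ≤ m) (k : FreqMomentum L M)
    (h : (klScale klE0 n / 4) ^ 2 ≤ matsubaraFreq β M k.1 ^ 2 + nambuXiCT L μ K k.2 ^ 2) :
    softSymbolCompl L M β μ K n m k = 1 - hubbardCutoffWeightCT L M β μ K (klScale klE0 n) k := by
  have hΛm := klth_klScale_pos m
  have hle : klScale klE0 m ^ 2 ≤ (klScale klE0 n / 4) ^ 2 := pow_le_pow_left₀ hΛm.le (klcd_klScale_le_quarter hnm) 2
  have h1 := klcd_cutoffWeight_eq_one_of_sq_le β μ K hΛm k (hle.trans h)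
  simp only [softSymbolCompl, h1]

/-- The complementary member is even in the frequency and in the momentum (as both weights are). [folklore] -/
theorem klcd_soft_even [NeZero M] (n m : ℕ) :
    (∀ k : FreqMomentum L M, softSymbolCompl L M β μ K n m (k.1.rev, k.2) = softSymbolCompl L M β μ K n m k) ∧
      ∀ k : FreqMomentum L M, softSymbolCompl L M β μ K n m (k.1, -k.2) = softSymbolCompl L M β μ K n m k := by
  refine ⟨fun k => ?_, fun k => ?_⟩
  · simp only [softSymbolCompl, hubbardCutoffWeightCT_revFreq L M β μ K _ k]
  · simp only [softSymbolCompl, hubbardCutoffWeightCT_neg_momentum β μ K _ k.1 k.2]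

/-- **Support of the transfer weight of a complementary member**: `n + 1 ≤ m`, `Λ_n + (4 + coeffNorm 1 K)·|p_Q|_𝕋 ≤ |e_K(p)|` ⟹ `t_n[s_{n,m}](Q,p) = 0`
(the member vanishes at `p` and, the band moving by at most `(4 + coeffNorm 1 K)|p_Q|_𝕋`, at `Q − p`). [folklore] -/
theorem klcd_transferWeight_eq_zero_of_far [NeZero M] {n m : ℕ} (hnm : n + 1 ≤ m) (Q p : TorusSite 2 L)
    (hfar : klScale klE0 n + (4 + K.coeffNorm 1) * klTorusNorm L Q ≤ |nambuXiCT L μ K p|) :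
    klTransferWeight L M β μ K n (softSymbolCompl L M β μ K n m) Q p = 0 := by
  have hvs : 0 ≤ (4 + K.coeffNorm 1) * klTorusNorm L Q :=
    mul_nonneg (by have := TrigPolyC4v.coeffNorm_nonneg 1 K; linarith) (EngineV8.klband_klTorusNorm_nonneg (L := L) Q)
  have h1 : ∀ ν : MatsubaraIdx M, softSymbolCompl L M β μ K n m (ν, p) = 0 := fun ν => by
    by_contra h
    have h' := (klcd_sq_lt_of_soft_ne_zero β μ K hnm (ν, p) h).2
    simp only at h'
    linarith
  have h2 : ∀ ν : MatsubaraIdx M, softSymbolCompl L M β μ K n m (ν, Q - p) = 0 := fun ν => by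
    by_contra h
    have h' := (klcd_sq_lt_of_soft_ne_zero β μ K hnm (ν, Q - p) h).2
    simp only at h'
    have he : nambuXiCT L μ K (Q - p) = nambuXiCT L μ K (p - Q) := by rw [← neg_sub, nambuXiCT_neg L μ K]
    rw [he] at h'
    have hd := klbj_abs_nambuXiCT_sub_sub_le μ K p Q
    have ht := abs_sub_abs_le_abs_sub (nambuXiCT L μ K p) (nambuXiCT L μ K (p - Q))
    rw [abs_sub_comm] at ht
    linarith
  unfold klTransferWeight
  simp [h1, h2]

/-- **The ball restriction is inactive**: for any `B ⊇ {p : |e_K(p)| < Λ_n + (4 + coeffNorm 1 K)|p_Q|_𝕋}`,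
`Σ_{p ∈ B} t_n[s_{n,m}](Q,p) = Σ_p t_n[s_{n,m}](Q,p)` (`n + 1 ≤ m`). [folklore] -/
theorem klcd_sum_transferWeight_subset_eq [NeZero M] {n m : ℕ} (hnm : n + 1 ≤ m) (Q : TorusSite 2 L) (B : Finset (TorusSite 2 L))
    (hB : ∀ p : TorusSite 2 L, |nambuXiCT L μ K p| < klScale klE0 n + (4 + K.coeffNorm 1) * klTorusNorm L Q → p ∈ B) :
    ∑ p ∈ B, klTransferWeight L M β μ K n (softSymbolCompl L M β μ K n m) Q p = ∑ p, klTransferWeight L M β μ K n (softSymbolCompl L M β μ K n m) Q p :=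
  Finset.sum_subset (Finset.subset_univ B) fun p _ hp =>
    klcd_transferWeight_eq_zero_of_far β μ K hnm Q p (not_lt.1 fun h => hp (hB p h))

/-! ## §2 Term 1: the three-point region of the member seen from a hard centre -/

/-- **Term 1, pointwise** (`0 < β`, `n + 1 ≤ m`, deep step `(4 + coeffNorm 1 K)·|p_Q|_𝕋 ≤ Λ_n/16`): at a frequency–momentum with `w_{Λ_n}(ν,p) ≠ 0` and the member
nonzero at one of `p, p ± Q`, with `Λ = Λ_n`, `A = Λ/2`, `g = 2/A`, `E = (Λ + Λ/16) + A/2`, `v = 4 + coeffNorm 1 K`, `κ = 4 + coeffNorm 2 K`, `s = |p_Q|_𝕋`: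
`‖δ²_Q(s_{n,m}·ĝ_K)(ν,p)‖ ≤ Φ₂·g + 2·Φ₁·(v·s)·g² + 1·((κ + 2v²g)·g²·s²)`, `Φ₁ = (8/3)(v·s·2E/Λ²)`, `Φ₂ = ((16/3)(Eκ + v²)/Λ² + (1408/9)E²v²/Λ⁴)·s²`. [folklore] -/
theorem klcd_term1_pointwise [NeZero M] (hβ : 0 < β) {n m : ℕ} (hnm : n + 1 ≤ m) (Q : TorusSite 2 L)
    (hdeep : (4 + K.coeffNorm 1) * klTorusNorm L Q ≤ klScale klE0 n / 16) (ν : MatsubaraIdx M) (p : TorusSite 2 L)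
    (hw : hubbardCutoffWeightCT L M β μ K (klScale klE0 n) (ν, p) ≠ 0)
    (hφ3 : softSymbolCompl L M β μ K n m (ν, p + Q) ≠ 0 ∨ softSymbolCompl L M β μ K n m (ν, p) ≠ 0 ∨ softSymbolCompl L M β μ K n m (ν, p - Q) ≠ 0) :
    ‖(softSymbolCompl L M β μ K n m (ν, p + Q) : ℂ) * propCT L M β μ K (ν, p + Q) -
          2 * ((softSymbolCompl L M β μ K n m (ν, p) : ℂ) * propCT L M β μ K (ν, p)) +
        (softSymbolCompl L M β μ K n m (ν, p - Q) : ℂ) * propCT L M β μ K (ν, p - Q)‖ ≤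
      (16 / 3 * (((klScale klE0 n + klScale klE0 n / 16) + klScale klE0 n / 2 / 2) * (4 + K.coeffNorm 2) + (4 + K.coeffNorm 1) ^ 2) / klScale klE0 n ^ 2 +
              1408 / 9 * ((klScale klE0 n + klScale klE0 n / 16) + klScale klE0 n / 2 / 2) ^ 2 * (4 + K.coeffNorm 1) ^ 2 / klScale klE0 n ^ 4) *
            klTorusNorm L Q ^ 2 * (2 / (klScale klE0 n / 2)) +
          2 * (8 / 3 * ((4 + K.coeffNorm 1) * klTorusNorm L Q * (2 * (((klScale klE0 n + klScale klE0 n / 16) + klScale klE0 n / 2 / 2))) /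
              klScale klE0 n ^ 2) * ((4 + K.coeffNorm 1) * klTorusNorm L Q * (2 / (klScale klE0 n / 2)) ^ 2)) +
        1 * (((4 + K.coeffNorm 2) + 2 * (4 + K.coeffNorm 1) ^ 2 * (2 / (klScale klE0 n / 2))) * (2 / (klScale klE0 n / 2)) ^ 2 * klTorusNorm L Q ^ 2) := by
  set Λ := klScale klE0 n with hΛdef
  have hΛ : 0 < Λ := klth_klScale_pos n
  have hA : 0 < Λ / 2 := by positivity
  have hv : 0 ≤ 4 + K.coeffNorm 1 := by have := TrigPolyC4v.coeffNorm_nonneg 1 K; linarith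
  have hs : 0 ≤ klTorusNorm L Q := EngineV8.klband_klTorusNorm_nonneg (L := L) Q
  have hvs : (4 + K.coeffNorm 1) * klTorusNorm L Q ≤ Λ / 2 / 2 := hdeep.trans (by linarith)
  -- centre shell fact
  have hA2 : (Λ / 2) ^ 2 ≤ matsubaraFreq β M ν ^ 2 + nambuXiCT L μ K p ^ 2 := klcd_sq_le_of_cutoffWeight_ne_zero β μ K hΛ (ν, p) hw
  -- centre band size from the member's support at one of the three points
  have hdp := klbj_abs_nambuXiCT_add_sub_le μ K p Q
  have hdm := klbj_abs_nambuXiCT_sub_sub_le μ K p Q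
  have hEc : |nambuXiCT L μ K p| ≤ Λ + Λ / 16 := by
    rcases hφ3 with h | h | h
    · have h1 := (klcd_sq_lt_of_soft_ne_zero β μ K hnm (ν, p + Q) h).2
      have h2 := abs_sub_abs_le_abs_sub (nambuXiCT L μ K p) (nambuXiCT L μ K (p + Q))
      rw [abs_sub_comm] at h2
      simp only at h1
      linarith
    · have h1 := (klcd_sq_lt_of_soft_ne_zero β μ K hnm (ν, p) h).2
      simp only at h1
      linarith
    · have h1 := (klcd_sq_lt_of_soft_ne_zero β μ K hnm (ν, p - Q) h).2
      have h2 := abs_sub_abs_le_abs_sub (nambuXiCT L μ K p) (nambuXiCT L μ K (p - Q))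
      rw [abs_sub_comm] at h2
      simp only at h1
      linarith
  -- transported sizes
  obtain ⟨gp, g0, gm⟩ := klrt_norm_propCT_three_le β μ K hA ν p Q hA2 hvs
  obtain ⟨ep, e0, em⟩ := klrt_abs_nambuXiCT_three_le μ K hA.le p Q hEc hvs
  -- flatness of the lower weight at the three points
  have hqp : (Λ / 2 / 2) ^ 2 ≤ matsubaraFreq β M ν ^ 2 + nambuXiCT L μ K (p + Q) ^ 2 := klrt_quarter_sq_le hA.le hA2 (hdp.trans hvs)
  have hqm : (Λ / 2 / 2) ^ 2 ≤ matsubaraFreq β M ν ^ 2 + nambuXiCT L μ K (p - Q) ^ 2 := klrt_quarter_sq_le hA.le hA2 (hdm.trans hvs)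
  have hq0 : (Λ / 2 / 2) ^ 2 ≤ matsubaraFreq β M ν ^ 2 + nambuXiCT L μ K p ^ 2 := hA2.trans' (by nlinarith)
  have e44 : Λ / 2 / 2 = Λ / 4 := by ring
  rw [e44] at hqp hqm hq0
  have fp := klcd_soft_eq_one_sub β μ K hnm (ν, p + Q) hqp
  have f0 := klcd_soft_eq_one_sub β μ K hnm (ν, p) hq0
  have fm := klcd_soft_eq_one_sub β μ K hnm (ν, p - Q) hqm
  -- profile sizes
  have h0 : |softSymbolCompl L M β μ K n m (ν, p - Q)| ≤ 1 := klrj_abs_softSymbolCompl_le_one β μ K n m (ν, p - Q)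
  have h1 : |softSymbolCompl L M β μ K n m (ν, p) - softSymbolCompl L M β μ K n m (ν, p - Q)| ≤
      8 / 3 * ((4 + K.coeffNorm 1) * klTorusNorm L Q * (2 * ((Λ + Λ / 16) + Λ / 2 / 2)) / Λ ^ 2) := by
    rw [f0, fm, show (1 - hubbardCutoffWeightCT L M β μ K Λ (ν, p)) - (1 - hubbardCutoffWeightCT L M β μ K Λ (ν, p - Q)) =
      -(hubbardCutoffWeightCT L M β μ K Λ (ν, p) - hubbardCutoffWeightCT L M β μ K Λ (ν, p - Q)) by ring, abs_neg]
    exact klrj_abs_cutoffWeight_sub_le' β μ K Λ ν p Q e0 em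
  have h2 : |softSymbolCompl L M β μ K n m (ν, p + Q) - 2 * softSymbolCompl L M β μ K n m (ν, p) + softSymbolCompl L M β μ K n m (ν, p - Q)| ≤
      (16 / 3 * (((Λ + Λ / 16) + Λ / 2 / 2) * (4 + K.coeffNorm 2) + (4 + K.coeffNorm 1) ^ 2) / Λ ^ 2 +
          1408 / 9 * ((Λ + Λ / 16) + Λ / 2 / 2) ^ 2 * (4 + K.coeffNorm 1) ^ 2 / Λ ^ 4) * klTorusNorm L Q ^ 2 := by
    rw [fp, f0, fm, show (1 - hubbardCutoffWeightCT L M β μ K Λ (ν, p + Q)) - 2 * (1 - hubbardCutoffWeightCT L M β μ K Λ (ν, p)) +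
        (1 - hubbardCutoffWeightCT L M β μ K Λ (ν, p - Q)) =
      -(hubbardCutoffWeightCT L M β μ K Λ (ν, p + Q) - 2 * hubbardCutoffWeightCT L M β μ K Λ (ν, p) + hubbardCutoffWeightCT L M β μ K Λ (ν, p - Q)) by ring,
      abs_neg]
    exact klrj_abs_cutoffWeight_secondDiff_le β μ K Λ ν p Q ep e0 em
  exact klrj_norm_weightedRung_secondDiff_le β μ K hβ.ne' (softSymbolCompl L M β μ K n m) ν p Q gp g0 gm h0 h1 h2

/-! ## §3 Term 2: the member's support seen from a hard three-point region -/

/-- **Term 2, pointwise** (`0 < β`, `n + 1 ≤ m`, deep step): at a frequency–momentum with `s_{n,m}(ν,p) ≠ 0` and `w_{Λ_n}` nonzero at one of `p, p ± Q`, with `Λ = Λ_n`,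
`A′ = Λ/4`: the soft line `|s_{n,m}(ν,p)|·‖ĝ_K(ν,p)‖ ≤ 1/A′` and `‖δ²_Q(w_{Λ_n}·ĝ_K)(ν,p)‖ ≤ C(Λ + A′/2, Λ, 2/A′)·|p_Q|_𝕋²` (row 21 §4's closed form). [folklore] -/
theorem klcd_term2_pointwise [NeZero M] (hβ : 0 < β) {n m : ℕ} (hnm : n + 1 ≤ m) (Q : TorusSite 2 L)
    (hdeep : (4 + K.coeffNorm 1) * klTorusNorm L Q ≤ klScale klE0 n / 16) (ν : MatsubaraIdx M) (p : TorusSite 2 L)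
    (hφ : softSymbolCompl L M β μ K n m (ν, p) ≠ 0)
    (hw3 : hubbardCutoffWeightCT L M β μ K (klScale klE0 n) (ν, p + Q) ≠ 0 ∨ hubbardCutoffWeightCT L M β μ K (klScale klE0 n) (ν, p) ≠ 0 ∨
      hubbardCutoffWeightCT L M β μ K (klScale klE0 n) (ν, p - Q) ≠ 0) :
    |softSymbolCompl L M β μ K n m (ν, p)| * ‖propCT L M β μ K (ν, p)‖ ≤ 1 / (klScale klE0 n / 4) ∧
      ‖(hubbardCutoffWeightCT L M β μ K (klScale klE0 n) (ν, p + Q) : ℂ) * propCT L M β μ K (ν, p + Q) -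
            2 * ((hubbardCutoffWeightCT L M β μ K (klScale klE0 n) (ν, p) : ℂ) * propCT L M β μ K (ν, p)) +
          (hubbardCutoffWeightCT L M β μ K (klScale klE0 n) (ν, p - Q) : ℂ) * propCT L M β μ K (ν, p - Q)‖ ≤
        ((16 / 3 * ((klScale klE0 n + klScale klE0 n / 4 / 2) * (4 + K.coeffNorm 2) + (4 + K.coeffNorm 1) ^ 2) / klScale klE0 n ^ 2 +
                1408 / 9 * (klScale klE0 n + klScale klE0 n / 4 / 2) ^ 2 * (4 + K.coeffNorm 1) ^ 2 / klScale klE0 n ^ 4) * (2 / (klScale klE0 n / 4)) +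
              2 * (8 / 3 * ((4 + K.coeffNorm 1) * (2 * (klScale klE0 n + klScale klE0 n / 4 / 2)) / klScale klE0 n ^ 2)) * (4 + K.coeffNorm 1) *
                (2 / (klScale klE0 n / 4)) ^ 2 +
            ((4 + K.coeffNorm 2) + 2 * (4 + K.coeffNorm 1) ^ 2 * (2 / (klScale klE0 n / 4))) * (2 / (klScale klE0 n / 4)) ^ 2) *
          klTorusNorm L Q ^ 2 := by
  set Λ := klScale klE0 n with hΛdef
  have hΛ : 0 < Λ := klth_klScale_pos n
  have hA : 0 < Λ / 4 := by positivity
  have hvs2 : (4 + K.coeffNorm 1) * klTorusNorm L Q ≤ Λ / 2 / 2 := hdeep.trans (by linarith)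
  have hvs : (4 + K.coeffNorm 1) * klTorusNorm L Q ≤ Λ / 4 / 2 := hdeep.trans (by linarith)
  have hdp := klbj_abs_nambuXiCT_add_sub_le μ K p Q
  have hdm := klbj_abs_nambuXiCT_sub_sub_le μ K p Q
  -- centre band size and centre shell fact (quarter lemma from the hard point)
  obtain ⟨-, hE⟩ := klcd_sq_lt_of_soft_ne_zero β μ K hnm (ν, p) hφ
  simp only at hE
  have hA2 : (Λ / 4) ^ 2 ≤ matsubaraFreq β M ν ^ 2 + nambuXiCT L μ K p ^ 2 := by
    have e24 : Λ / 2 / 2 = Λ / 4 := by ring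
    rcases hw3 with h | h | h
    · have h1 := klcd_sq_le_of_cutoffWeight_ne_zero β μ K hΛ (ν, p + Q) h
      have h2 : |nambuXiCT L μ K p - nambuXiCT L μ K (p + Q)| ≤ Λ / 2 / 2 := by rw [abs_sub_comm]; exact hdp.trans hvs2
      rw [← e24]; exact klrt_quarter_sq_le (by positivity) h1 h2
    · exact (klcd_sq_le_of_cutoffWeight_ne_zero β μ K hΛ (ν, p) h).trans' (by nlinarith)
    · have h1 := klcd_sq_le_of_cutoffWeight_ne_zero β μ K hΛ (ν, p - Q) h
      have h2 : |nambuXiCT L μ K p - nambuXiCT L μ K (p - Q)| ≤ Λ / 2 / 2 := by rw [abs_sub_comm]; exact hdm.trans hvs2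
      rw [← e24]; exact klrt_quarter_sq_le (by positivity) h1 h2
  obtain ⟨gp, g0, gm⟩ := klrt_norm_propCT_three_le β μ K hA ν p Q hA2 hvs
  obtain ⟨ep, e0, em⟩ := klrt_abs_nambuXiCT_three_le μ K hA.le p Q hE.le hvs
  refine ⟨?_, klrj_norm_cutoffWeightedRung_secondDiff_le β μ K hβ.ne' Λ ν p Q gp g0 gm ep e0 em⟩
  have hg := klrt_norm_propCT_le_one_div β μ K hA (ν, p) hA2
  have h1 := klrj_abs_softSymbolCompl_le_one β μ K n m (ν, p)
  calc |softSymbolCompl L M β μ K n m (ν, p)| * ‖propCT L M β μ K (ν, p)‖ ≤ 1 * (1 / (Λ / 4)) := mul_le_mul h1 hg (norm_nonneg _) zero_le_one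
    _ = 1 / (Λ / 4) := one_mul _

end ComplDeep

end Summit.HubbardSuperconductivity.HubbardSuperconductivity.Theorems.KLRegimeSplit

end
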